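import Literature.NumberTheory.Rogawski1990.LocalNormFibreBlockDichotomy            -- ★ p841369 F0P3a-p08: `exists_unitary_conj_frame_or`, `not_frame_and_frame` (frame currency over `E_v`)
import Literature.NumberTheory.Rogawski1990.FinExplicitTransferFactorNondegenerate   -- ★ `isUnit_eval_finCharpolyTwo_of_isLocalGRegular`; brings ★ `LocalTransfer` (`IsLocalNormPair`, `IsLocalGRegular`)
import Literature.NumberTheory.Rogawski1990.ExplicitFactorKappaAlmostEverywhereOne  -- ★ `conjLocal_finGammaTwo_mul_finGammaTwo`
import Literature.NumberTheory.Automorphic.LocalRegularOrbitClosed                  -- ★ `map_conjLocal_transpose_localForm`, `isUnit_det_localForm`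
import HarnessLib

/-!
# The norm fibre at a `(G,H)`-regular singular pair, CM READING: a `G`-regular `γ_H = (A, b)` matched with `γ′ ∈ G′_v` puts `γ′`, up to `G′_v`-conjugacy, into the
# frame of `ε` or of `ε′` with second block `b` — never both (Rogawski 1990, §3.8 Prop. 3.8.1 (d); §8.1)

Topic `NumberTheory/Rogawski1990`; namespace `Literature.NumberTheory.Rogawski1990`.  THEOREMS ONLY (no definition, no instance, no notation, no named fact,
no `sorry`).  Cell `pub/hodgecm-mathlib` (D-0151), crux H413 = stmt-HodgeConjecture-24833, F0∕P3a road «D-N6-ns», floor-2 line «N6nsGerm», stub `stub_N6nsS1`;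
brick **B3-alg** (FILE 3 of 3, the CM reading) of the (α′) junction `LocalTransferCentralSingularJunctionCM` (F0P2-p02 (g8); LEAD F0P3a-plan (g9) T8-63 (B), T8-65 (2));
seat F0P3a-p08 (g13).  HONEST LABEL: HC_CM is proved only modulo the printed citations until rung 0 closes; unconditional local algebra, no letter.

THE MATHEMATICS.  On the CM carriers (`G′_v = (cmDatum L 3 H′).Local v`, `H_v = (cmDatum L 2 Φ₂).Local v × (cmDatum L 1 Φ₁).Local v`, `σ_v = c ⊗ 1`, local form
`H′_v`): `IsLocalNormPair γ_H γ′` is `GL₃`-conjugacy of `ι_v(γ_H)` with `γ′`, and `ι_v(γ_H) = W (A ⊕ᶠ b) W` for the swap `W` of the coordinates `2 ↔ 3` (★ `coe_endoGL_eq`: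
the printed picture `(a 0 b; 0 u 0; c 0 d)`), so `γ′ (yW) = (yW)(A ⊕ᶠ b)` is a frame with scalar second block `b = γ₂`, `σ(b) b = 1` (★ `conjLocal_finGammaTwo_mul_finGammaTwo`)
and `χ_A(b)` a unit (★ `isUnit_eval_finCharpolyTwo_of_isLocalGRegular`).  ★ FILE 2 `exists_unitary_conj_frame_or` ∕ `not_frame_and_frame` then read, for frames `P`, `P′` of
`H′_v` with different rank-2 Gram classes: **`exists_conj_frame_or_of_isLocalNormPair`** — some `x ∈ G′_v` has `(x γ′ x⁻¹) P = P (B ⊕ᶠ γ₂)` or some has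
`(x γ′ x⁻¹) P′ = P′ (B ⊕ᶠ γ₂)` — and **`not_frame_and_frame_of_isLocalNormPair`** (never both, since `χ_B = χ_{B′} = χ_A`).  This is binder B3 of the junction
under the `Ad(Z(ε))`-invariant descent design (no neighbourhoods, no saturation).

## References
* [Rogawski1990] J. D. Rogawski, *Automorphic Representations of Unitary Groups in Three Variables*, Ann. of Math. Stud. 123 (1990): §3.8 Prop. 3.8.1 (d) p. 30; §4.8 Case (a)
  p. 53 (the embedding `ι`); §8.1 pp. 115–116.
-/

set_option autoImplicit false

noncomputable section

open NumberField IsDedekindDomain Matrix Polynomial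
open scoped MatrixGroups

namespace Literature.NumberTheory.Rogawski1990

open Literature.NumberTheory.Automorphic Literature.NumberTheory.Automorphic.UnitaryGroup
open Literature.AlgebraicGeometry.ShimuraVarieties (unitaryGroup)

section CM

variable (L : Type) [Field L] [NumberField L] [IsCMField L] (H' : Matrix (Fin 3) (Fin 3) L) (v : HeightOneSpectrum (𝓞 ↥(maximalRealSubfield L)))

/-- `B ⊕ᶠ C` in coordinates. [folklore] -/
private theorem finSum_two_one_eq₂ {R : Type*} [CommRing R] (B : Matrix (Fin 2) (Fin 2) R) (C : Matrix (Fin 1) (Fin 1) R) :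
    finSum 2 1 B C = !![B 0 0, B 0 1, 0; B 1 0, B 1 1, 0; 0, 0, C 0 0] := by
  ext i j
  fin_cases i <;> fin_cases j <;> simp [finSum, Matrix.fromBlocks, finSumFinEquiv, Fin.addCases]

/-- The swap `W` of the coordinates `2 ↔ 3` conjugates `ι(g₂, g₁)` (printed picture `(a 0 b; 0 u 0; c 0 d)`) to `g₂ ⊕ᶠ g₁`: `ι(g₂, g₁) · W = W · (g₂ ⊕ᶠ g₁)`.
[cite: Rogawski1990, §4.8 Case (a) p. 53] -/
theorem coe_endoGL_mul_swap {S : Type*} [CommRing S] (g₂ : GL (Fin 2) S) (g₁ : GL (Fin 1) S) :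
    (endoGL (g₂, g₁) : GL (Fin 3) S).val * !![(1 : S), 0, 0; 0, 0, 1; 0, 1, 0] =
      !![(1 : S), 0, 0; 0, 0, 1; 0, 1, 0] * finSum 2 1 g₂.val g₁.val := by
  rw [coe_endoGL_eq, finSum_two_one_eq₂]
  ext i j
  fin_cases i <;> fin_cases j <;> simp [Matrix.mul_apply, Fin.sum_univ_three]

/-- The coordinate swap `2 ↔ 3` as a unit (an involution). [folklore] -/
private theorem exists_units_swap (S : Type*) [CommRing S] :
    ∃ W : GL (Fin 3) S, (W : Matrix (Fin 3) (Fin 3) S) = !![(1 : S), 0, 0; 0, 0, 1; 0, 1, 0] := by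
  have hW : !![(1 : S), 0, 0; 0, 0, 1; 0, 1, 0] * !![(1 : S), 0, 0; 0, 0, 1; 0, 1, 0] = 1 := by
    ext i j
    fin_cases i <;> fin_cases j <;> simp [Matrix.mul_apply, Fin.sum_univ_three]
  exact ⟨⟨_, _, hW, hW⟩, rfl⟩

/-- A `1 × 1` matrix is the scalar of its entry. [folklore] -/
private theorem fin_one_eq_smul_one {S : Type*} [CommRing S] (C : Matrix (Fin 1) (Fin 1) S) : C = C 0 0 • (1 : Matrix (Fin 1) (Fin 1) S) := by
  ext i j
  obtain rfl : i = 0 := Subsingleton.elim _ _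
  obtain rfl : j = 0 := Subsingleton.elim _ _
  simp

/-- **THE FRAME HANDED OVER BY A NORM PAIR.**  `γ_H = (A, b)` `G`-regular, `γ′ ∈ G′_v` with `IsLocalNormPair γ_H γ′`: there is `Q ∈ GL₃(L ⊗ L⁺_v)` with
`γ′ Q = Q (A ⊕ᶠ b·1)`, `σ_v(b) b = 1` and `χ_A(b)` a unit (`Q := y W` for the `GL₃`-conjugator `y` and the coordinate swap `W`).
[cite: Rogawski1990, §4.8 Case (a) p. 53; §3.8 Prop. 3.8.1 (d) p. 30] -/
theorem exists_frame_of_isLocalNormPair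
    {γH : (cmDatum L 2 (Matrix.of fun i j : Fin 2 => if i.val + j.val + 1 = 2 then (1 : L) else 0)).Local v ×
      (cmDatum L 1 (Matrix.of fun i j : Fin 1 => if i.val + j.val + 1 = 1 then (1 : L) else 0)).Local v}
    (hreg : IsLocalGRegular L v γH) {γ' : (cmDatum L 3 H').Local v} (h : IsLocalNormPair L H' v γH γ') :
    ∃ Q : GL (Fin (2 + 1)) (LocalRing L v),
      (γ'.val.val : Matrix (Fin 3) (Fin 3) (LocalRing L v)) * Q.val =
          Q.val * finSum 2 1 (γH.1.val.val : Matrix (Fin 2) (Fin 2) (LocalRing L v)) (finGammaTwo L v γH • (1 : Matrix (Fin 1) (Fin 1) (LocalRing L v))) ∧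
        conjLocal L (IsCMField.complexConj L) v (finGammaTwo L v γH) * finGammaTwo L v γH = 1 ∧
        IsUnit ((γH.1.val.val : Matrix (Fin 2) (Fin 2) (LocalRing L v)).charpoly.eval (finGammaTwo L v γH)) := by
  obtain ⟨y, hy⟩ := isConj_iff.1 h
  -- `ι_v(γ_H) = endoGL (A, b)` on the nose (definitional)
  have hy' : y * endoGL ((γH.1.val : GL (Fin 2) (LocalRing L v)), (γH.2.val : GL (Fin 1) (LocalRing L v))) * y⁻¹ = γ'.val := hy
  -- the swap as a unit
  obtain ⟨W, hW⟩ := exists_units_swap (LocalRing L v)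
  refine ⟨y * W, ?_, conjLocal_finGammaTwo_mul_finGammaTwo L v γH, ?_⟩
  · have hyι : (γ'.val.val : Matrix (Fin 3) (Fin 3) (LocalRing L v)) * y.val =
        y.val * (endoGL ((γH.1.val : GL (Fin 2) (LocalRing L v)), (γH.2.val : GL (Fin 1) (LocalRing L v)))).val := by
      rw [← hy']
      simp only [Units.val_mul, Matrix.mul_assoc, ← Units.val_mul y⁻¹ y, inv_mul_cancel, Units.val_one, Matrix.mul_one]
    have hb : finGammaTwo L v γH • (1 : Matrix (Fin 1) (Fin 1) (LocalRing L v)) = γH.2.val.val := (fin_one_eq_smul_one _).symm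
    rw [hb, Units.val_mul, hW, ← Matrix.mul_assoc, hyι, Matrix.mul_assoc, coe_endoGL_mul_swap, ← Matrix.mul_assoc]
  · exact isUnit_eval_finCharpolyTwo_of_isLocalGRegular L v γH hreg

/-- **B3 (CM READING): THE DICHOTOMY FOR MATCHED CLASSES AT `(εH; ε, ε′)`.**  `v` non-split, `H′` hermitian with `det H′ ≠ 0`; frames `P`, `P′` of the local form `H′_v`
with block-diagonal Gram matrices whose rank-2 determinant classes differ (the two classes `ε`, `ε′` of the stable class of `ι(a·1₂, u)`); `γ_H` `G`-regular matched with
`γ′ ∈ G′_v`.  Then some `x ∈ G′_v` has `(x γ′ x⁻¹) P = P (B ⊕ᶠ γ₂)` or some has `(x γ′ x⁻¹) P′ = P′ (B ⊕ᶠ γ₂)` (`γ₂ = γ_H.2`, as a `1 × 1` block).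
[cite: Rogawski1990, §3.8 Prop. 3.8.1 (d) p. 30; §8.1 pp. 115–116] -/
theorem exists_conj_frame_or_of_isLocalNormPair (w : PlacesOver L v) (hw : IsCMField.complexConj L • w.1 = w.1)
    (hH' : (H'.map (cmConjRingHom L))ᵀ = H') (hdet' : H'.det ≠ 0)
    {P P' : GL (Fin (2 + 1)) (LocalRing L v)} {G₁ G₁' : Matrix (Fin 2) (Fin 2) (LocalRing L v)} {G₂ G₂' : Matrix (Fin 1) (Fin 1) (LocalRing L v)}
    (hP : twistGram (conjLocal L (IsCMField.complexConj L) v) ((adelicForm L 3 H').map (adeleToLocal L v)) P.val = finSum 2 1 G₁ G₂)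
    (hP' : twistGram (conjLocal L (IsCMField.complexConj L) v) ((adelicForm L 3 H').map (adeleToLocal L v)) P'.val = finSum 2 1 G₁' G₂')
    (hnn : ¬ ∃ z : LocalRing L v, IsUnit z ∧ G₁'.det = G₁.det * (conjLocal L (IsCMField.complexConj L) v z * z))
    {γH : (cmDatum L 2 (Matrix.of fun i j : Fin 2 => if i.val + j.val + 1 = 2 then (1 : L) else 0)).Local v ×
      (cmDatum L 1 (Matrix.of fun i j : Fin 1 => if i.val + j.val + 1 = 1 then (1 : L) else 0)).Local v}
    (hreg : IsLocalGRegular L v γH) {γ' : (cmDatum L 3 H').Local v} (h : IsLocalNormPair L H' v γH γ') :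
    (∃ x : (cmDatum L 3 H').Local v, ∃ B : Matrix (Fin 2) (Fin 2) (LocalRing L v),
        ((x * γ' * x⁻¹).val.val : Matrix (Fin 3) (Fin 3) (LocalRing L v)) * P.val =
          P.val * finSum 2 1 B (γH.2.val.val : Matrix (Fin 1) (Fin 1) (LocalRing L v))) ∨
      (∃ x : (cmDatum L 3 H').Local v, ∃ B : Matrix (Fin 2) (Fin 2) (LocalRing L v),
        ((x * γ' * x⁻¹).val.val : Matrix (Fin 3) (Fin 3) (LocalRing L v)) * P'.val =
          P'.val * finSum 2 1 B (γH.2.val.val : Matrix (Fin 1) (Fin 1) (LocalRing L v))) := by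
  haveI : Algebra.IsQuadraticExtension ↥(maximalRealSubfield L) L := IsCMField.isQuadraticExtension L
  -- an anti-fixed non-zero `δ`
  obtain ⟨δ, hcδ, hδ⟩ : ∃ δ : L, IsCMField.complexConj L δ = -δ ∧ δ ≠ 0 := by
    have hne : IsCMField.complexConj L ≠ 1 := IsCMField.complexConj_ne_one (K := L)
    obtain ⟨z, hz⟩ : ∃ z : L, IsCMField.complexConj L z ≠ z := by
      by_contra hall
      exact hne (AlgEquiv.ext fun z => not_not.mp (not_exists.mp hall z))
    refine ⟨z - IsCMField.complexConj L z, ?_, sub_ne_zero.2 (Ne.symm hz)⟩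
    rw [map_sub, IsCMField.complexConj_apply_apply, neg_sub]
  have hHv := map_conjLocal_transpose_localForm L 3 H' v hH'
  have hHvd := isUnit_det_localForm L 3 H' v hdet'
  obtain ⟨Q, hQ, hl, hχ⟩ := exists_frame_of_isLocalNormPair L H' v hreg h
  have hb : (γH.2.val.val : Matrix (Fin 1) (Fin 1) (LocalRing L v)) = finGammaTwo L v γH • (1 : Matrix (Fin 1) (Fin 1) (LocalRing L v)) :=
    fin_one_eq_smul_one _
  -- (subgroup memberships are passed by definitional unfolding, never by `mem_…_iff` rewriting)
  rcases exists_unitary_conj_frame_or L v (IsCMField.complexConj L) hcδ hδ w hw hHv hHvd hP hP' hnn γ'.2 hQ hl hχ with ⟨x, hx, B, hxB⟩ | ⟨x, hx, B, hxB⟩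
  · left
    refine ⟨⟨x, hx⟩, B, ?_⟩
    rw [hb]
    exact hxB
  · right
    refine ⟨⟨x, hx⟩, B, ?_⟩
    rw [hb]
    exact hxB

/-- **NEVER BOTH (CM READING).**  With the frame data of `exists_conj_frame_or_of_isLocalNormPair`, no matched `γ′` has a `G′_v`-conjugate in the frame of `P` AND one in the
frame of `P′` with second block `γ₂` and first blocks `B`, `B′` such that `χ_B(γ₂)`, `χ_{B′}(γ₂)` are units (automatic when `χ_B = χ_{B′} = χ_A` by `G`-regularity).
[cite: Rogawski1990, §3.8 Prop. 3.8.1 (d) p. 30; §8.1 pp. 115–116] -/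
theorem not_frame_and_frame_of_local
    {P P' : GL (Fin (2 + 1)) (LocalRing L v)} {G₁ G₁' : Matrix (Fin 2) (Fin 2) (LocalRing L v)} {G₂ G₂' : Matrix (Fin 1) (Fin 1) (LocalRing L v)}
    (hP : twistGram (conjLocal L (IsCMField.complexConj L) v) ((adelicForm L 3 H').map (adeleToLocal L v)) P.val = finSum 2 1 G₁ G₂)
    (hP' : twistGram (conjLocal L (IsCMField.complexConj L) v) ((adelicForm L 3 H').map (adeleToLocal L v)) P'.val = finSum 2 1 G₁' G₂')
    (hnn : ¬ ∃ z : LocalRing L v, IsUnit z ∧ G₁'.det = G₁.det * (conjLocal L (IsCMField.complexConj L) v z * z))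
    {γ' x x' : (cmDatum L 3 H').Local v} {B B' : Matrix (Fin 2) (Fin 2) (LocalRing L v)} {l : LocalRing L v}
    (hB : ((x * γ' * x⁻¹).val.val : Matrix (Fin 3) (Fin 3) (LocalRing L v)) * P.val =
      P.val * finSum 2 1 B (l • (1 : Matrix (Fin 1) (Fin 1) (LocalRing L v))))
    (hB' : ((x' * γ' * x'⁻¹).val.val : Matrix (Fin 3) (Fin 3) (LocalRing L v)) * P'.val =
      P'.val * finSum 2 1 B' (l • (1 : Matrix (Fin 1) (Fin 1) (LocalRing L v))))
    (hχ : IsUnit (B.charpoly.eval l)) (hχ' : IsUnit (B'.charpoly.eval l)) : False :=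
  not_frame_and_frame L v (IsCMField.complexConj L) hP hP' hnn (γ := (γ'.val : GL (Fin 3) (LocalRing L v))) x.2 x'.2 hB hB' hχ hχ'

end CM

end Literature.NumberTheory.Rogawski1990

end
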